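import Mathlib
import Summits.KontsevichZagierPeriods.KontsevichZagierPeriods.Theses.InverseLandau
import Literature.NumberTheory.Transcendental.KZCalculus
import Literature.NumberTheory.Transcendental.KZBetaChains
import Literature.NumberTheory.Transcendental.KZDominatedFamilyRelations
import Summits.KontsevichZagierPeriods.KontsevichZagierPeriods.Theorems.InverseLandauTateLiftingPullback

/-!
# `TateLifting` (stmt-KontsevichZagierPeriods-9129), line `Sketch` — stub `duplicationFamily`:
# Legendre's duplication formula `B(a,a) = 2^{1−2a} B(1/2,a)` inside the Kontsevich–Zagier rules

For every rational `a > 0` and ANY two Kontsevich–Zagier integral representations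
`r = [(0,1), (x(1−x))^{a−1}]` and `r' = [(0,1), 2^{1−2a} x^{−1/2} (1−x)^{a−1}]` on `ℝ¹ = Fin 1 → ℝ`
(domains `{x | x 0 ∈ Ioo 0 1}`, integrands pinned on them) we prove `KZ.Equivalent r r'`, i.e.
`[r] − [r'] ∈ KZ.relations` (`tateLifting_duplicationFamily`; verbatim the shared open item
`DuplicationFamily`, stmt-KontsevichZagierPeriods-3727, of the routes CubicTransport / MellinCoarea /
TwoRouteTransport; its instance `a = 1/3` is LowDimension's `LowdimDuplicationOneThird`). The value
identity is Legendre's duplication formula `B(a,a) = 2^{1−2a} B(1/2,a)`; no Gamma function appears.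

The move chain (five elementary moves of the calculus):

1. remove the null point `x = 1/2` from `(0,1)` (`KZ.IntegralRep.of_sub_of_restrict_mem_relations`) and
   split `(0,1) ∖ {1/2} = (0,1/2) ⊔ (1/2,1)` by domain additivity (rule (1a), `KZ.domainAddRel`);
2. fold `(1/2,1)` onto `(0,1/2)` by the reflection `x ↦ 1 − x` (rule (2),
   `KZ.of_sub_of_mem_relations_of_boxReflection`): the integrand `(x(1−x))^{a−1}` is symmetric, so
   `[(0,1), f] ≡ 2 • [(0,1/2), f]`;
3. ONE change of variables (rule (2)) `u = Φ(x) = (1 − 2x)² = 1 − 4x(1−x)` from `(0,1/2)` onto `(0,1)`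
   (a `ℚ`-polynomial, injective with `Φ' = −4(1−2x) ≠ 0`, inverse `x = (1 − √u)/2`), realised as the
   honest pull-back `P = [(0,1/2), |Φ'|·(g ∘ Φ)]` of the GIVEN `r' = [(0,1), g]`
   (`InverseLandau.tateLifting_pullback_dimOne`: integrability of the pulled-back integrand is Mathlib's
   Jacobian criterion, so `0 < a` is not even needed);
4. the Jacobian identity on `(0,1/2)` (`DuplicationFamily.jacobian_identity`):
   `4(1−2x) · 2^{1−2a} ((1−2x)²)^{−1/2} (1 − (1−2x)²)^{a−1} = 2 (x(1−x))^{a−1}`, because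
   `1 − (1−2x)² = 4x(1−x)`, `(4x(1−x))^{a−1} = 4^{a−1}(x(1−x))^{a−1}` and `2^{1−2a}·4^{a−1} = 1/2`;
   hence `[P] − [(0,1/2), f] − [(0,1/2), f]` is ONE integrand-additivity move (rule (1b)).

Everything is chained in the free abelian group `KZ.FormalRep`. No definition is introduced.

References: M. Kontsevich, D. Zagier, *Periods* (2001), §1.2 rules (1), (2); G. E. Andrews,
R. Askey, R. Roy, *Special Functions* (1999), Thm. 1.5.1 (Legendre duplication via the Beta integral).
-/

noncomputable section

open MeasureTheory Set
open Literature.NumberTheory.Transcendental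
open Literature.ModelTheory.ExponentialFields (IsSemialgebraic)
open MvPolynomial (X C aeval)

namespace Summit.KontsevichZagierPeriods.InverseLandau

namespace DuplicationFamily

/-- **The Jacobian identity of the substitution `u = (1 − 2t)²`** on `(0,1/2)`:
`4(1−2t) · (2^{1−2α} ((1−2t)²)^{−1/2} (1 − (1−2t)²)^{α−1}) = 2 (t(1−t))^{α−1}`, from
`((1−2t)²)^{−1/2} = (1−2t)⁻¹`, `1 − (1−2t)² = 4t(1−t)`, `(4t(1−t))^{α−1} = 4^{α−1}(t(1−t))^{α−1}` and
`2^{1−2α} 4^{α−1} = 1/2`. [folklore] -/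
theorem jacobian_identity (α : ℝ) {t : ℝ} (ht : t ∈ Set.Ioo (0:ℝ) (1/2)) :
    4 * (1 - 2 * t) * ((2:ℝ) ^ (1 - 2 * α) * ((1 - 2 * t) ^ 2) ^ (-(1:ℝ)/2) *
      (1 - (1 - 2 * t) ^ 2) ^ (α - 1)) =
    (t * (1 - t)) ^ (α - 1) + (t * (1 - t)) ^ (α - 1) := by
  have hs : 0 < 1 - 2 * t := by linarith [ht.2]
  have hq : 0 ≤ t * (1 - t) := mul_nonneg ht.1.le (by linarith [ht.2])
  have h1 : ((1 - 2 * t) ^ 2) ^ (-(1:ℝ)/2) = (1 - 2 * t)⁻¹ := by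
    rw [show ((1 - 2 * t) ^ 2 : ℝ) = (1 - 2 * t) ^ ((2:ℕ):ℝ) from (Real.rpow_natCast _ 2).symm,
      ← Real.rpow_mul hs.le, show ((2:ℕ):ℝ) * (-(1:ℝ)/2) = -1 by norm_num, Real.rpow_neg_one]
  have h2 : 1 - (1 - 2 * t) ^ 2 = 4 * (t * (1 - t)) := by ring
  have h3 : (4 * (t * (1 - t))) ^ (α - 1) = (4:ℝ) ^ (α - 1) * (t * (1 - t)) ^ (α - 1) :=
    Real.mul_rpow (by norm_num) hq
  have h4 : (2:ℝ) ^ (1 - 2 * α) * (4:ℝ) ^ (α - 1) = 2⁻¹ := by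
    rw [show (4:ℝ) = (2:ℝ) ^ (2:ℝ) by rw [Real.rpow_two]; norm_num,
      ← Real.rpow_mul (by norm_num : (0:ℝ) ≤ 2), ← Real.rpow_add (by norm_num : (0:ℝ) < 2),
      show 1 - 2 * α + 2 * (α - 1) = -1 by ring, Real.rpow_neg_one]
  rw [h1, h2, h3]
  calc 4 * (1 - 2 * t) * ((2:ℝ) ^ (1 - 2 * α) * (1 - 2 * t)⁻¹ *
        ((4:ℝ) ^ (α - 1) * (t * (1 - t)) ^ (α - 1)))
      = 4 * ((1 - 2 * t) * (1 - 2 * t)⁻¹) * ((2:ℝ) ^ (1 - 2 * α) * (4:ℝ) ^ (α - 1)) *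
          (t * (1 - t)) ^ (α - 1) := by ring
    _ = (t * (1 - t)) ^ (α - 1) + (t * (1 - t)) ^ (α - 1) := by
        rw [mul_inv_cancel₀ hs.ne', h4]
        ring

/-- The left half `(0,1/2) ⊆ ℝ¹` (first-coordinate spelling) is `ℚ`-semialgebraic. [folklore] -/
theorem isSemialgebraic_leftHalf :
    IsSemialgebraic ℚ {x : Fin 1 → ℝ | x 0 ∈ Set.Ioo (0:ℝ) (1/2)} := by
  convert KZ.BallPeeling.isSemialgebraic_Ioo₁ 0 (1/2) using 1
  push_cast
  rfl

/-- The right half `(1/2,1) ⊆ ℝ¹` (first-coordinate spelling) is `ℚ`-semialgebraic. [folklore] -/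
theorem isSemialgebraic_rightHalf :
    IsSemialgebraic ℚ {x : Fin 1 → ℝ | x 0 ∈ Set.Ioo (1/2:ℝ) 1} := by
  convert KZ.BallPeeling.isSemialgebraic_Ioo₁ (1/2) 1 using 1
  push_cast
  rfl

/-- The substitution `u = (1 − 2t)²` maps `(0,1/2)` onto `(0,1)` (inverse `t = (1 − √u)/2`), read on
`ℝ¹`. [folklore] -/
theorem image_sqOneSubTwoMul :
    (fun y : Fin 1 → ℝ => fun _ : Fin 1 => (1 - 2 * y 0) ^ 2) ''
        {x : Fin 1 → ℝ | x 0 ∈ Set.Ioo (0:ℝ) (1/2)} = {x | x 0 ∈ Set.Ioo (0:ℝ) 1} := by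
  ext u
  constructor
  · rintro ⟨y, hy, rfl⟩
    have h1 : 0 < 1 - 2 * y 0 := by linarith [hy.2]
    have h2 : 1 - 2 * y 0 < 1 := by linarith [hy.1]
    exact ⟨by positivity, pow_lt_one₀ h1.le h2 two_ne_zero⟩
  · intro hu
    have hu' : u 0 ∈ Set.Ioo (0:ℝ) 1 := hu
    have h1 : 0 < Real.sqrt (u 0) := Real.sqrt_pos.2 hu'.1
    have h2 : Real.sqrt (u 0) < 1 := by
      rw [← Real.sqrt_one]
      exact Real.sqrt_lt_sqrt hu'.1.le hu'.2
    refine ⟨fun _ => (1 - Real.sqrt (u 0)) / 2, ?_, ?_⟩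
    · show (1 - Real.sqrt (u 0)) / 2 ∈ Set.Ioo (0:ℝ) (1/2)
      constructor <;> linarith
    · funext i
      obtain rfl : i = 0 := Fin.fin_one_eq_zero i
      have : 1 - 2 * ((1 - Real.sqrt (u 0)) / 2) = Real.sqrt (u 0) := by ring
      show (1 - 2 * ((1 - Real.sqrt (u 0)) / 2)) ^ 2 = u 0
      rw [this, Real.sq_sqrt hu'.1.le]

/-- The substitution `u = (1 − 2t)²` is injective on `(0,1/2)` (where `1 − 2t > 0`), read on `ℝ¹`.
[folklore] -/
theorem injOn_sqOneSubTwoMul :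
    Set.InjOn (fun y : Fin 1 → ℝ => fun _ : Fin 1 => (1 - 2 * y 0) ^ 2)
      {x : Fin 1 → ℝ | x 0 ∈ Set.Ioo (0:ℝ) (1/2)} := by
  intro y hy z hz hyz
  have h0 : (1 - 2 * y 0) ^ 2 = (1 - 2 * z 0) ^ 2 := congrFun hyz 0
  have hy' : 0 < 1 - 2 * y 0 := by linarith [hy.2]
  have hz' : 0 < 1 - 2 * z 0 := by linarith [hz.2]
  have h1 := (sq_eq_sq₀ hy'.le hz'.le).1 h0
  funext i
  obtain rfl : i = 0 := Fin.fin_one_eq_zero i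
  linarith

end DuplicationFamily

open DuplicationFamily

/-- **Stub `duplicationFamily`** (= item `DuplicationFamily`, stmt-KontsevichZagierPeriods-3727, of the
routes CubicTransport / MellinCoarea / TwoRouteTransport, verbatim): Legendre's duplication formula
`B(a,a) = 2^{1−2a} B(1/2,a)` INSIDE the Kontsevich–Zagier rules. For every rational `a > 0`, any
representation `[(0,1), (x(1−x))^{a−1}]` is KZ-equivalent to any representation
`[(0,1), 2^{1−2a} x^{−1/2}(1−x)^{a−1}]`: split `(0,1)` at the null point `1/2` (rule (1a)), fold the
right half onto the left by `x ↦ 1 − x` (rule (2)), pull `[(0,1), g]` back along `u = (1 − 2x)²`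
(rule (2), `|du/dx| = 4(1−2x)`), and merge `2•[(0,1/2), f] ≡ [(0,1/2), 2f]` (rule (1b)) using the
Jacobian identity `4(1−2x)·g((1−2x)²) = 2 (x(1−x))^{a−1}`.
[cite: KontsevichZagier2001, §1.2 rule (2)] -/
theorem tateLifting_duplicationFamily :
    ∀ a : ℚ, 0 < a → ∀ (r r' : KZ.IntegralRep 1), r.domain = {x | x 0 ∈ Set.Ioo (0:ℝ) 1} → Set.EqOn r.integrand (fun x => (x 0 * (1 - x 0)) ^ ((a:ℝ) - 1)) r.domain → r'.domain = {x | x 0 ∈ Set.Ioo (0:ℝ) 1} → Set.EqOn r'.integrand (fun x => (2:ℝ) ^ (1 - 2 * (a:ℝ)) * (x 0) ^ (-(1:ℝ)/2) * (1 - x 0) ^ ((a:ℝ) - 1)) r'.domain → KZ.Equivalent r r' := by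
  intro a _ r r' hrd hri hr'd hr'i
  -- the two halves of `(0,1)` and the punctured interval
  set L : Set (Fin 1 → ℝ) := {x | x 0 ∈ Set.Ioo (0:ℝ) (1/2)} with hL_def
  set R : Set (Fin 1 → ℝ) := {x | x 0 ∈ Set.Ioo (1/2:ℝ) 1} with hR_def
  have hL : IsSemialgebraic ℚ L := isSemialgebraic_leftHalf
  have hR : IsSemialgebraic ℚ R := isSemialgebraic_rightHalf
  have hLr : L ⊆ r.domain := fun x hx => by
    rw [hrd]
    exact ⟨hx.1, by linarith [hx.2]⟩
  have hRr : R ⊆ r.domain := fun x hx => by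
    rw [hrd]
    exact ⟨by linarith [hx.1], hx.2⟩
  have hEr : L ∪ R ⊆ r.domain := union_subset hLr hRr
  -- (1) remove the null point `1/2`
  have hvol : volume (r.domain \ (L ∪ R)) = 0 := by
    refine measure_mono_null (fun x hx => ?_)
      (KZ.BallPeeling.volume_setOf_apply_eq_const 1 (0 : Fin 1) (1/2))
    rw [hrd] at hx
    obtain ⟨hxS, hxE⟩ := hx
    have hxS' : x 0 ∈ Set.Ioo (0:ℝ) 1 := hxS
    simp only [mem_union, not_or] at hxE
    have h1 : ¬ x 0 < 1/2 := fun h => hxE.1 ⟨hxS'.1, h⟩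
    have h2 : ¬ 1/2 < x 0 := fun h => hxE.2 ⟨h, hxS'.2⟩
    show x 0 = 1/2
    exact le_antisymm (not_lt.1 h2) (not_lt.1 h1)
  have hA : KZ.of r - KZ.of (r.restrict (L ∪ R) (hL.union hR) hEr) ∈ KZ.relations :=
    r.of_sub_of_restrict_mem_relations (hL.union hR) hEr hvol
  -- (1a) split the punctured interval into its two halves
  have hB : KZ.of (r.restrict (L ∪ R) (hL.union hR) hEr) - KZ.of (r.restrict L hL hLr) -
      KZ.of (r.restrict R hR hRr) ∈ KZ.relations := by
    refine KZ.domainAddRel_subset_relations ⟨1, r.restrict (L ∪ R) (hL.union hR) hEr,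
      r.restrict L hL hLr, r.restrict R hR hRr, rfl, ?_, fun _ _ => rfl, fun _ _ => rfl, rfl⟩
    show volume (L ∩ R) = 0
    have : L ∩ R = ∅ := by
      ext x
      simp only [hL_def, hR_def, mem_inter_iff, mem_setOf_eq, mem_Ioo, mem_empty_iff_false,
        iff_false, not_and, and_imp]
      intro _ h2 h3 _
      linarith
    rw [this, measure_empty]
  -- (2) fold the right half onto the left half by `x ↦ 1 − x`
  have hC : KZ.of (r.restrict R hR hRr) - KZ.of (r.restrict L hL hLr) ∈ KZ.relations := by
    refine KZ.of_sub_of_mem_relations_of_boxReflection (0 : Fin 1) ?_ fun x hx => ?_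
    · show R = KZ.boxReflection 0 ⁻¹' L
      ext x
      simp only [hL_def, hR_def, mem_setOf_eq, mem_preimage, KZ.boxReflection_apply_self, mem_Ioo]
      constructor <;> rintro ⟨h1, h2⟩ <;> constructor <;> linarith
    · have hxR : x 0 ∈ Set.Ioo (1/2:ℝ) 1 := hx
      have hxS : x ∈ r.domain := hRr hx
      have hx'S : KZ.boxReflection 0 x ∈ r.domain := by
        rw [hrd]
        show KZ.boxReflection 0 x 0 ∈ Set.Ioo (0:ℝ) 1
        rw [KZ.boxReflection_apply_self]
        exact ⟨by linarith [hxR.2], by linarith [hxR.1]⟩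
      show r.integrand x = r.integrand (KZ.boxReflection 0 x)
      rw [hri hxS, hri hx'S]
      simp only [KZ.boxReflection_apply_self, sub_sub_cancel]
      rw [mul_comm]
  -- (3) pull `r'` back along `u = (1 − 2x)²` onto the left half
  have hφ : IsSemialgebraicFunOn ℚ L (fun y : Fin 1 → ℝ => (1 - 2 * y 0) ^ 2) :=
    (isSemialgebraicFunOn_aeval hL ((1 - 2 * X 0) ^ 2 : MvPolynomial (Fin 1) ℚ)).congr
      fun y _ => by simp
  have hder : ∀ y ∈ L, HasDerivAt (fun t : ℝ => (1 - 2 * t) ^ 2) (-(4 * (1 - 2 * y 0))) (y 0) := by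
    intro y _
    refine ((((hasDerivAt_id' (y 0)).const_mul (2:ℝ)).const_sub (1:ℝ)).fun_pow 2).congr_deriv ?_
    simp only [Nat.cast_ofNat, Nat.reduceSub, pow_one, mul_one]
    ring
  have hJ : IsSemialgebraicFunOn ℚ L (fun y : Fin 1 → ℝ => 4 * (1 - 2 * y 0)) :=
    (isSemialgebraicFunOn_aeval hL (4 * (1 - 2 * X 0) : MvPolynomial (Fin 1) ℚ)).congr
      fun y _ => by simp
  have hJdet : ∀ y ∈ L, 4 * (1 - 2 * y 0) = |(-(4 * (1 - 2 * y 0)))| := fun y hy => by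
    have : 0 < 1 - 2 * y 0 := by linarith [hy.2]
    rw [abs_neg, abs_of_pos (by positivity)]
  have himg : (fun y : Fin 1 → ℝ => fun _ : Fin 1 => (1 - 2 * y 0) ^ 2) '' L = r'.domain := by
    rw [hr'd]
    exact image_sqOneSubTwoMul
  obtain ⟨P, hPd, hPi, hD⟩ := tateLifting_pullback_dimOne r' L (fun t => (1 - 2 * t) ^ 2)
    (fun t => -(4 * (1 - 2 * t))) (fun y => 4 * (1 - 2 * y 0)) hL hφ hder injOn_sqOneSubTwoMul
    himg hJ hJdet
  -- (4) the Jacobian identity: `[P] − [L, f] − [L, f]` is integrand additivity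
  have hE : KZ.of P - KZ.of (r.restrict L hL hLr) - KZ.of (r.restrict L hL hLr) ∈ KZ.relations := by
    have hdom : (r.restrict L hL hLr).domain = P.domain := by
      rw [hPd]
      rfl
    refine KZ.integrandAddRel_subset_relations ⟨1, P, _, _, hdom, hdom, fun y hy => ?_, rfl⟩
    rw [hPd] at hy
    have hyL : y 0 ∈ Set.Ioo (0:ℝ) (1/2) := hy
    have hyS : y ∈ r.domain := hLr hy
    have huS : (fun _ : Fin 1 => (1 - 2 * y 0) ^ 2) ∈ r'.domain := by
      rw [← himg]
      exact mem_image_of_mem _ hy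
    have e1 : r.integrand y = (y 0 * (1 - y 0)) ^ ((a:ℝ) - 1) := hri hyS
    have e2 : r'.integrand (fun _ : Fin 1 => (1 - 2 * y 0) ^ 2) =
        (2:ℝ) ^ (1 - 2 * (a:ℝ)) * ((1 - 2 * y 0) ^ 2) ^ (-(1:ℝ)/2) *
          (1 - (1 - 2 * y 0) ^ 2) ^ ((a:ℝ) - 1) := hr'i huS
    rw [hPi]
    show 4 * (1 - 2 * y 0) * r'.integrand (fun _ : Fin 1 => (1 - 2 * y 0) ^ 2) =
      r.integrand y + r.integrand y
    rw [e1, e2]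
    exact jacobian_identity (a:ℝ) hyL
  -- assemble in the free abelian group
  show KZ.of r - KZ.of r' ∈ KZ.relations
  have : KZ.of r - KZ.of r' =
      (KZ.of r - KZ.of (r.restrict (L ∪ R) (hL.union hR) hEr)) +
      (KZ.of (r.restrict (L ∪ R) (hL.union hR) hEr) - KZ.of (r.restrict L hL hLr) -
        KZ.of (r.restrict R hR hRr)) +
      (KZ.of (r.restrict R hR hRr) - KZ.of (r.restrict L hL hLr)) -
      (KZ.of P - KZ.of (r.restrict L hL hLr) - KZ.of (r.restrict L hL hLr)) -
      (KZ.of r' - KZ.of P) := by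
    abel
  rw [this]
  exact KZ.relations.sub_mem (KZ.relations.sub_mem
    (KZ.relations.add_mem (KZ.relations.add_mem hA hB) hC) hE) hD

end Summit.KontsevichZagierPeriods.InverseLandau

end
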